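import Literature.NumberTheory.NumberFields.ClassNumberDivisibilityInExtensions
import Literature.NumberTheory.QuadraticFields.KroneckerSplitting
import Literature.NumberTheory.QuadraticFields.SquareRootGenerator
import Literature.NumberTheory.EllipticCurves.HeegnerPoints
import Literature.NumberTheory.EllipticCurves.Rank1Residual.Predicates
import Literature.NumberTheory.EllipticCurves.ModularityVersionApProofs
import Mathlib.Algebra.QuadraticAlgebra.Basic
import Mathlib.NumberTheory.LegendreSymbol.QuadraticReciprocity
import HarnessLib

/-!
# Route BiquadraticEisensteinDescent — the admissibility conjunct of KS DESCENDS to the Heegner field: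
# `(∀ quartic M ∋ √d_CM, √d_K′ : p ∤ h(M)) ⟹ p ∤ h(K′)` for odd `p` (item stmt-BirchSwinnertonDyer-20198)

The crux KS = `HeegnerFieldSupplyCMInertBadAdm` asks for an imaginary quadratic `K′` with (among
other things) the ADMISSIBILITY conjunct «every quartic number field `M` containing a square root of
`d_CM = cmFieldDiscrOfJ W.j` and a square root of `d_K′` has `p ∤ h(M)`» — in the corner (`p` inert
in `K_CM`, split in `K′`) such an `M` is the biquadratic field `K_CM·K′`, so this is `p ∤ h(K_CM·K′)`;
the same binder is the hypothesis `hadm` of the cruxes E♭°/W♭/C′. The cell dossier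
(HEART-KS-DOSSIER v1.2 §4, «Δ-h⁻») proposes to weaken it to `p ∤ h(K′)`; the route author flagged
that the glue then needs «`p ∤ h(L) ⇒ p ∤ h(K′)` … the lemma `h(K′) ∣ h(L)`-type fact … CHECK».
This file supplies that check as THEOREMS (no definition, no named fact, no `sorry`):

* `not_dvd_classNumber_of_not_dvd_finrank` — for number fields `K ⊆ M` and a prime `p ∤ [M : K]`:
  `p ∤ h_M ⟹ p ∤ h_K` (from the tree's `h_K ∣ [M : K]·h_M`, Washington Prop. 4.11 (proof),
  `ClassNumberDivisibilityInExtensions.lean`);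
* `not_dvd_classNumber_of_forall_quartic` — for a quadratic field `K`, an integer `d` that is not a
  square in `K` and an odd prime `p`: the quartic binder for `(d, d_K)` implies `p ∤ h_K` (witness
  `M = K(√d)`, Mathlib's `QuadraticAlgebra K d 0`, a field since `d` is a non-square; `√d_K ∈ K` by the
  tree's `exists_sq_eq_discr`);
* `forall_sq_ne_cmFieldDiscrOfJ` — for `p ≠ 2` with `CMInert W p` and `p` split in the quadratic
  field `K`, `d_CM` is NOT a square in `K` (a square root `z` is either rational — then `d_CM` is a
  square mod `p` — or generates `K`, and then `d_K = d_CM·q²` (tree: `NumberField.exists_discr_eq_mul_sq`)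
  and `(d_K/p) = 1` (tree: `ncard_primesOver_eq_two_iff_legendreSym`) again make `d_CM` a square mod
  `p`; both contradict `CMInert`);
* `not_dvd_classNumber_heegnerField_of_admissible` — IN THE ROUTE'S BINDERS: `CMInert W p`,
  `¬ Good W p`, `K′` imaginary quadratic with the Heegner hypothesis for `N_W`, `p ≠ 2`, and the
  admissibility binder VERBATIM ⟹ `¬ p ∣ classNumber K′`.

So the typed (quartic) admissibility is at least as strong as the `K′`-form; the converse direction
(«`p ∤ h(K′) ∧ p ∤ h(ℚ(√(d_CM·d_K′))) ⟹` quartic binder», Kuroda/Herglotz for odd `p`) is the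
companion file's business. Helper toward KS (`--supports` stmt-BirchSwinnertonDyer-20198); it closes
nothing and asserts nothing about the crux's open coupling (twist `L`-value × class number).
Prover seat bsd-wall-bed-p2 (g6), 2026-08-27.

References: [Washington1997] Prop. 4.11; [Marcus2018] Ch. 2 Thm. 1, Ch. 3 Thm. 25;
[IrelandRosen1990] Prop. 13.1.3; cell dossier HOME/bsd-wall-cm/g5/HEART-KS-DOSSIER-v1.2.md §4–§5.
-/

set_option autoImplicit false

-- D-0017 layout: summit = sub-problem, so `Summit.BirchSwinnertonDyer.BirchSwinnertonDyer.…` is the mandated namespace.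
set_option linter.dupNamespace false

open scoped NumberField
open Module NumberField

namespace Summit.BirchSwinnertonDyer.BirchSwinnertonDyer.Theorems.BiquadraticEisensteinDescentHeegnerFieldSupplyAdmissibilityDescends

/-- **A prime `p ∤ [M : K]` dividing `h_K` divides `h_M`** (from the tree's
`h_K ∣ [M : K] · h_M`, Washington Prop. 4.11 (proof)); contrapositive form. [folklore] -/
theorem not_dvd_classNumber_of_not_dvd_finrank (K M : Type) [Field K] [NumberField K] [Field M]
    [NumberField M] [Algebra K M] {p : ℕ} (hp : p.Prime) (hpn : ¬ p ∣ finrank K M)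
    (hM : ¬ p ∣ classNumber M) : ¬ p ∣ classNumber K := by
  intro hK
  have h := hK.trans (Literature.NumberTheory.NumberFields.classNumber_dvd_finrank_mul_classNumber K M)
  rcases (Nat.Prime.dvd_mul hp).mp h with h1 | h2
  · exact hpn h1
  · exact hM h2

/-- **The admissibility conjunct of KS descends to `K′`.** Let `K` be a quadratic field, `d` an
integer which is not a square in `K`, and `p` an odd prime. If every quartic number field containing a
square root of `d` and a square root of `d_K` has class number prime to `p`, then `p ∤ h_K`: the
field `M = K(√d)` is such a quartic field and `h_K ∣ [M : K] · h_M = 2 h_M`. [folklore] -/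
theorem not_dvd_classNumber_of_forall_quartic (K : Type) [Field K] [NumberField K]
    (h2 : finrank ℚ K = 2) {d : ℤ} (hd : ∀ z : K, z ^ 2 ≠ (d : K)) {p : ℕ} (hp : p.Prime)
    (hp2 : p ≠ 2)
    (hAdm : ∀ (M : Type) [Field M] [NumberField M], finrank ℚ M = 4 →
      (∃ x : M, x ^ 2 = ((d : ℤ) : M)) → (∃ y : M, y ^ 2 = ((NumberField.discr K : ℤ) : M)) →
      ¬ p ∣ classNumber M) :
    ¬ p ∣ classNumber K := by
  haveI : Fact (∀ r : K, r ^ 2 ≠ (d : K) + 0 * r) := ⟨fun r h => hd r (by rw [h]; ring)⟩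
  let M := QuadraticAlgebra K (d : K) 0
  haveI : NumberField M := NumberField.of_module_finite K M
  have h2M : finrank K M = 2 := by convert QuadraticAlgebra.finrank_eq_two (d : K) (0 : K)
  have h4 : finrank ℚ M = 4 := by rw [← finrank_mul_finrank ℚ K M, h2, h2M]
  have hx : ∃ x : M, x ^ 2 = ((d : ℤ) : M) := by
    refine ⟨QuadraticAlgebra.omega, ?_⟩
    have h := QuadraticAlgebra.omega_mul_omega_eq_add (a := (d : K)) (b := (0 : K))
    rw [zero_smul, add_zero] at h
    rw [sq, h, ← Algebra.algebraMap_eq_smul_one, map_intCast]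
  have hy : ∃ y : M, y ^ 2 = ((NumberField.discr K : ℤ) : M) := by
    obtain ⟨t, m, δ, -, hδ⟩ := Literature.NumberTheory.QuadraticFields.Quadratic.exists_sq_eq_discr h2
    refine ⟨algebraMap K M (δ : K), ?_⟩
    rw [← map_pow]
    have : ((δ : K)) ^ 2 = (NumberField.discr K : K) := by
      have h := congrArg ((↑) : 𝓞 K → K) hδ
      push_cast at h
      exact h
    rw [this, map_intCast]
  have hM := hAdm M h4 hx hy
  exact not_dvd_classNumber_of_not_dvd_finrank K M hp (by rw [h2M]; exact fun h => hp2 ((Nat.prime_dvd_prime_iff_eq hp Nat.prime_two).mp h)) hM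


/-- **A rational square root of an integer is an integer square root mod `p`**: if `r² = d` with
`r ∈ ℚ`, `d ∈ ℤ`, then `d` is a square in `ZMod p`. [folklore] -/
theorem isSquare_intCast_zmod_of_rat_sq_eq {d : ℤ} {r : ℚ} (hr : r ^ 2 = (d : ℚ)) (p : ℕ) :
    IsSquare ((d : ℤ) : ZMod p) := by
  have hint : IsIntegral ℤ r := by
    refine ⟨Polynomial.X ^ 2 - Polynomial.C d, by monicity!, ?_⟩
    simp only [Polynomial.eval₂_sub, Polynomial.eval₂_X_pow, Polynomial.eval₂_C]
    rw [hr]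
    simp
  obtain ⟨n, hn⟩ := IsIntegrallyClosed.isIntegral_iff.mp hint
  rw [← hn, eq_intCast] at hr
  have hd : n ^ 2 = d := by exact_mod_cast hr
  exact ⟨n, by rw [← hd]; push_cast; ring⟩

/-- **From `d_K = d·q²` (rational `q ≠ 0`) and `p ∤ d`: `(d_K/p) = 1 ⟹ d` is a square mod `p`.**
Clearing denominators, `d_K·b² = d·a²` with `gcd(a,b) = 1`; `p ∣ a` would force `p ∣ b`.
[folklore] -/
theorem isSquare_zmod_of_discr_eq_mul_sq {D d : ℤ} {q : ℚ} (hq : (D : ℚ) = d * q ^ 2) {p : ℕ}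
    [Fact p.Prime] (hD : legendreSym p D = 1) : IsSquare ((d : ℤ) : ZMod p) := by
  have hp : p.Prime := Fact.out
  -- clear denominators: `D * den² = d * num²`
  have hden : (q.den : ℚ) ≠ 0 := by exact_mod_cast q.den_ne_zero
  have hnum : q * q.den = q.num := Rat.mul_den_eq_num q
  have hZ : D * (q.den : ℤ) ^ 2 = d * q.num ^ 2 := by
    have h : (D : ℚ) * (q.den : ℚ) ^ 2 = (d : ℚ) * (q.num : ℚ) ^ 2 := by
      rw [hq, ← hnum]; ring
    exact_mod_cast h
  have hD0 : ((D : ℤ) : ZMod p) ≠ 0 := fun h0 => by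
    rw [(legendreSym.eq_zero_iff p D).mpr h0] at hD
    exact zero_ne_one hD
  obtain ⟨s, hs⟩ := (legendreSym.eq_one_iff p hD0).mp hD
  have hmod : ((D : ℤ) : ZMod p) * ((q.den : ℤ) : ZMod p) ^ 2 =
      ((d : ℤ) : ZMod p) * ((q.num : ℤ) : ZMod p) ^ 2 := by
    have := congrArg (fun z : ℤ => (z : ZMod p)) hZ
    push_cast at this ⊢
    exact this
  -- `p ∤ num`: otherwise `p ∣ D den²`, `p ∤ D`, so `p ∣ den`, contradicting `gcd(num, den) = 1`
  have hnum0 : ((q.num : ℤ) : ZMod p) ≠ 0 := by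
    intro h0
    rw [h0, zero_pow two_ne_zero, mul_zero] at hmod
    have hden0 : ((q.den : ℤ) : ZMod p) = 0 := by
      rcases mul_eq_zero.mp hmod with h | h
      · exact absurd h hD0
      · exact pow_eq_zero_iff (n := 2) two_ne_zero |>.mp h
    have hpnum : (p : ℤ) ∣ q.num := (ZMod.intCast_zmod_eq_zero_iff_dvd q.num p).mp h0
    have hpden : (p : ℤ) ∣ (q.den : ℤ) := (ZMod.intCast_zmod_eq_zero_iff_dvd (q.den : ℤ) p).mp hden0
    have h1 : p ∣ q.num.natAbs := Int.ofNat_dvd_left.mp hpnum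
    have h2 : p ∣ q.den := by exact_mod_cast hpden
    have h3 : p ∣ Nat.gcd q.num.natAbs q.den := Nat.dvd_gcd h1 h2
    rw [q.reduced] at h3
    exact hp.ne_one (Nat.dvd_one.mp h3)
  refine ⟨s * ((q.den : ℤ) : ZMod p) * (((q.num : ℤ) : ZMod p))⁻¹, ?_⟩
  have hinv : ((q.num : ℤ) : ZMod p) * (((q.num : ℤ) : ZMod p))⁻¹ = 1 :=
    mul_inv_cancel₀ hnum0
  calc ((d : ℤ) : ZMod p)
      = ((d : ℤ) : ZMod p) * (((q.num : ℤ) : ZMod p) * (((q.num : ℤ) : ZMod p))⁻¹) ^ 2 := by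
        rw [hinv, one_pow, mul_one]
    _ = (((d : ℤ) : ZMod p) * ((q.num : ℤ) : ZMod p) ^ 2) * ((((q.num : ℤ) : ZMod p))⁻¹) ^ 2 := by
        ring
    _ = (((D : ℤ) : ZMod p) * ((q.den : ℤ) : ZMod p) ^ 2) * ((((q.num : ℤ) : ZMod p))⁻¹) ^ 2 := by
        rw [hmod]
    _ = _ := by rw [hs]; ring

open Literature.NumberTheory.EllipticCurves in
/-- **For a prime `p ≠ 2` inert in the CM field and split in the quadratic field `K`, the CM
discriminant `d_CM` is not a square in `K`.** If `z² = d_CM` with `z ∈ K` then either `z ∈ ℚ`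
(so `d_CM` is a square mod `p`) or `K = ℚ(z)` and `d_K = d_CM·q²` (the tree's
`NumberField.exists_discr_eq_mul_sq`), and `p` split in `K` means `(d_K/p) = 1`
(`ncard_primesOver_eq_two_iff_legendreSym`), so again `d_CM` is a square mod `p` — contradicting
`CMInert W p` (`p ∤ d_CM` and `d_CM` a non-square mod `p`). [folklore] -/
theorem forall_sq_ne_cmFieldDiscrOfJ (W : WeierstrassCurve ℚ) [W.IsElliptic] {p : ℕ} [Fact p.Prime]
    (hp2 : p ≠ 2) (hin : Rank1Residual.CMInert W p) (K : Type) [Field K] [NumberField K]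
    (h2 : finrank ℚ K = 2) (hsplit : ((Ideal.span {(p : ℤ)}).primesOver (𝓞 K)).ncard = 2) :
    ∀ z : K, z ^ 2 ≠ (Rank1Residual.cmFieldDiscrOfJ W.j : K) := by
  set d := Rank1Residual.cmFieldDiscrOfJ W.j with hd
  have hns : ¬ IsSquare ((d : ℤ) : ZMod p) := by
    intro hsq
    refine hin.2 ⟨hin.1, ?_⟩
    rw [if_neg hp2]
    exact hsq
  intro z hz
  by_cases hzr : z ∈ Set.range (algebraMap ℚ K)
  · obtain ⟨r, rfl⟩ := hzr
    have hr : r ^ 2 = (d : ℚ) := by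
      apply (algebraMap ℚ K).injective
      rw [map_pow, hz, map_intCast]
    exact hns (isSquare_intCast_zmod_of_rat_sq_eq hr p)
  · have hc : z ^ 2 = algebraMap ℚ K (d : ℚ) := by rw [hz, map_intCast]
    obtain ⟨q, -, hq⟩ := NumberField.exists_discr_eq_mul_sq h2 hzr hc
    have hleg : legendreSym p (NumberField.discr K) = 1 :=
      (Literature.NumberTheory.QuadraticFields.Quadratic.ncard_primesOver_eq_two_iff_legendreSym
        h2 hp2).mp hsplit
    exact hns (isSquare_zmod_of_discr_eq_mul_sq hq hleg)

open Literature.NumberTheory.EllipticCurves in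
/-- **KS's admissibility conjunct descends to the Heegner field, in the binders of the route.**
For `W` with `p ≠ 2` of inert type in the CM field (`CMInert W p`) and bad (`¬ Good W p`, so
`p ∣ N_W`), and an imaginary quadratic `K′` with the Heegner hypothesis for `N_W` (so `p` splits in
`K′`): if every quartic number field containing `√d_CM` and `√d_K′` has class number prime to `p` —
the admissibility conjunct of `HeegnerFieldSupplyCMInertBadAdm` (stmt-BirchSwinnertonDyer-20198) and
the hypothesis `hadm` of E♭°/W♭/C′ — then `p ∤ h(K′)`. (So the typed quartic binder IMPLIES the
`K′`-form binder of the dossier's Δ-h⁻; the converse needs the real quadratic `ℚ(√(d_CM d_K′))` too.)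
[folklore] -/
theorem not_dvd_classNumber_heegnerField_of_admissible (W : WeierstrassCurve ℚ) [W.IsElliptic]
    {p : ℕ} [Fact p.Prime] (hp2 : p ≠ 2) (hin : Rank1Residual.CMInert W p)
    (hbad : ¬ Rank1Residual.Good W p) (K : Type) [Field K] [NumberField K]
    (hK : IsImaginaryQuadratic K) (hHN : SatisfiesHeegnerHypothesis (W.conductorNorm ℤ) K)
    (hAdm : ∀ (M : Type) [Field M] [NumberField M], finrank ℚ M = 4 →
      (∃ x : M, x ^ 2 = ((Rank1Residual.cmFieldDiscrOfJ W.j : ℤ) : M)) →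
      (∃ y : M, y ^ 2 = ((NumberField.discr K : ℤ) : M)) → ¬ p ∣ NumberField.classNumber M) :
    ¬ p ∣ NumberField.classNumber K := by
  have hp : p.Prime := Fact.out
  have hpN : p ∣ W.conductorNorm ℤ := (W.dvd_conductorNorm_iff_not_hasGoodReductionAtPrime p).mpr hbad
  have hsplit : ((Ideal.span {(p : ℤ)}).primesOver (𝓞 K)).ncard = 2 := hHN p hp hpN
  exact not_dvd_classNumber_of_forall_quartic K hK.1 (forall_sq_ne_cmFieldDiscrOfJ W hp2 hin K hK.1 hsplit)
    hp hp2 hAdm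

end Summit.BirchSwinnertonDyer.BirchSwinnertonDyer.Theorems.BiquadraticEisensteinDescentHeegnerFieldSupplyAdmissibilityDescends
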